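import Literature.Topology.FourManifolds.RebuildUpperArchFormulas
import Literature.Topology.FourManifolds.PlanarConvexFamilyAntitone
import Literature.Topology.FourManifolds.SlideReshapeLower
import HarnessLib

/-!
# Reshaping the upper arch of the rebuilt attaching circle: the planar family

Topic `Literature/Topology/FourManifolds`; fact seat `provefact-IsStrictHandleSlide.isSurgery`
(R. C. Kirby, *The Topology of 4-Manifolds*, LNM 1374 (1989), Ch. I §4; remaining content: the
named fact (S) `Literature.Topology.FourManifolds.FramedLink.IsStrictHandleSlide.slideModel`).
Mirror of `SlideReshapeLower.lean` for the upper arch `cUp` (parameters `t ∈ [thi, ahi)`, from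
the push-off back to `A`, first coordinate non-increasing): any **admissible second upper track**
`(X₁, H₁)` — agreeing with `cUp` off `(thi + ε'/2, ahi - ε')`, abscissa non-increasing in `[0, 1]`,
heights in `(1/2, 9/10)`, below `gUp` where it lies on the right edge, injective and regular,
co-monotone with `cUp` on common plateaux — interpolates with `cUp` through a planar family for
`K♮` (`BandData.planarFamily_convex_antitone`). Proved here (no definitions, no named facts):

* `BandCore.false_of_typeA_up`, `BandCore.false_of_typeB_up`, `BandCore.false_of_typeO_lo_up`,
  `BandCore.planarFamily_upperTrack`.

## References

* R. C. Kirby, *The Topology of 4-Manifolds*, LNM 1374, Springer (1989), Ch. I §4. [Kirby1989]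
* M. W. Hirsch, *Differential Topology* (1976), Ch. 8 §1, Thm. 1.3. [HirschDT1976]
-/

open scoped Manifold ContDiff Topology Real
open Function Set Metric

noncomputable section

namespace Literature.Topology.FourManifolds

namespace BandCore

variable {A B : Knot} {avoid : Set (Metric.sphere (0 : EuclideanSpace ℝ (Fin 4)) 1)} (c : BandCore A B avoid)

/-- Disjointness (upper), type A parameters. [folklore] -/
theorem false_of_typeA_up {x : EuclideanSpace ℝ (Fin 2)} (hxsq : x ∈ squareNhd c.δ)
    {s t : ℝ} (hs : s ∈ Icc (c.thi + c.epsHi / 4) (c.ahi - c.epsHi / 2)) (ht : t ∈ Ico c.alo (c.alo + 1))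
    (hts : t ∉ Icc (c.thi + c.epsHi / 4) (c.ahi - c.epsHi / 2))
    (hA : t ≤ c.alo + c.epsLo ∨ c.ahi - c.epsHi ≤ t)
    (hleft : x 0 = 0 → c.ahi - c.epsHi ≤ s ∧ x = c.cUp s)
    (he : ((c.band x : Metric.sphere (0 : EuclideanSpace ℝ (Fin 4)) 1) : EuclideanSpace ℝ (Fin 4)) = c.pieceFun t) : False := by
  have hm := c.marks_lt
  have hε := c.epsHi_bounds.1
  rw [c.pieceFun_typeA ht hA, Knot.curve_apply] at he
  have hmem : c.band x ∈ range ⇑A := ⟨circlePt t, (Subtype.ext he).symm⟩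
  have hx00 : x 0 = 0 := by
    by_contra h; exact c.band_not_mem_range_A hxsq h hmem
  obtain ⟨hsge, hxeq⟩ := hleft hx00
  rw [hxeq, c.band_cUp_eq_A ⟨hsge, by linarith [hs.2, hm.2.2.2.2.2.1]⟩] at he
  have hst : circlePt s = circlePt t := A.injective (Subtype.ext he)
  obtain ⟨n, hn⟩ := circlePt_eq_circlePt_iff.1 hst
  have hn1 : (n : ℝ) < 1 := by linarith [ht.1, hs.2, hm.2.2.2.2.2.1, hm.2.2.2.2.2.2.1, hm.2.2.2.2.2.2.2, hm.2.2.1, hm.2.2.2.1]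
  have hn2 : (-1 : ℝ) < n := by linarith [ht.2, hs.1, hm.2.2.1, hm.2.2.2.1]
  have hn1' : n < 1 := by exact_mod_cast hn1
  have hn2' : -1 < n := by exact_mod_cast hn2
  obtain rfl : n = 0 := by omega
  simp only [Int.cast_zero, add_zero] at hn
  exact hts (hn ▸ hs)

/-- Disjointness (upper), type B parameters: a track point on the right edge at a height
`≤ gUp s`, `h > 1/2`, is no point of the `B`-piece before `s` modulo the period. [folklore] -/
theorem false_of_typeB_up {x : EuclideanSpace ℝ (Fin 2)} (hxsq : x ∈ squareNhd c.δ)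
    (hx1I : x 1 ∈ Ioo (2⁻¹ : ℝ) (9 / 10))
    {s t : ℝ} (hs : s ∈ Icc (c.thi + c.epsHi / 4) (c.ahi - c.epsHi / 2))
    (hts : t ∉ Icc (c.thi + c.epsHi / 4) (c.ahi - c.epsHi / 2))
    (hB : t ∈ Icc (c.tlo - c.epsLo) (c.thi + c.epsHi))
    (hright : x 0 = 1 → s ≤ c.thi + 2 * c.epsHi ∧ x 1 ≤ c.gUp s)
    (he : ((c.band x : Metric.sphere (0 : EuclideanSpace ℝ (Fin 4)) 1) : EuclideanSpace ℝ (Fin 4)) = c.pieceFun t) : False := by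
  have hm := c.marks_lt
  obtain ⟨hε, hε5, hεlam⟩ := c.epsLo_bounds
  obtain ⟨hε', hε'5, hε'lam⟩ := c.epsHi_bounds
  rw [c.pieceFun_typeB hB, Knot.curve_apply] at he
  have hmem : c.band x ∈ range ⇑B := ⟨circlePt (c.psi t), (Subtype.ext he).symm⟩
  have hx01 : x 0 = 1 := by
    by_contra h; exact c.band_not_mem_range_B hxsq h hmem
  obtain ⟨hsle, hle⟩ := hright hx01
  have hh : x 1 ∈ Icc (10⁻¹ : ℝ) (9 / 10) := ⟨by linarith [hx1I.1], hx1I.2.le⟩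
  have hxeq : x = pt2 1 (x 1) := by
    ext i; fin_cases i
    · exact hx01
    · rfl
  rw [hxeq, ← c.apply_circlePt_thetaB hh] at he
  have hst : circlePt (c.thetaB (x 1)) = circlePt (c.psi t) := B.injective (Subtype.ext he)
  obtain ⟨n, hn⟩ := circlePt_eq_circlePt_iff.1 hst
  have hanti := c.strictAntiOn_thetaB
  obtain ⟨h1m, h2m⟩ := c.thi_marksB
  -- `gUp s = heightB (psi s - 1)`, `thetaB (gUp s) = psi s - 1`
  have hsI' : s ∈ Icc (c.psiInv (c.thetaB (17 / 20) + 1)) (c.psiInv (c.thetaB (13 / 20) + 1)) :=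
    ⟨by linarith [hs.1], by linarith⟩
  have hgUp : c.gUp s = c.heightB (c.psi s - 1) := c.gUp_spec.2.1 s hsI'
  have hpsiI : c.psi s - 1 ∈ Icc (c.thetaB (9 / 10)) (c.thetaB 10⁻¹) := by
    have hl := c.strictMono_psi
    have h1 : c.psi (c.psiInv (c.thetaB (17 / 20) + 1)) ≤ c.psi s := hl.monotone hsI'.1
    have h2 : c.psi s ≤ c.psi (c.psiInv (c.thetaB (13 / 20) + 1)) := hl.monotone hsI'.2
    rw [c.psi_psiInv] at h1 h2
    have h3 : c.thetaB (9 / 10) ≤ c.thetaB (17 / 20) := hanti.antitoneOn (by norm_num) (by norm_num) (by norm_num)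
    have h4 : c.thetaB (13 / 20) ≤ c.thetaB 10⁻¹ := hanti.antitoneOn (by norm_num) (by norm_num) (by norm_num)
    exact ⟨by linarith, by linarith⟩
  have hθgUp : c.thetaB (c.gUp s) = c.psi s - 1 := by rw [hgUp]; exact (c.thetaB_heightB hpsiI).1
  have hgI : c.gUp s ∈ Icc (10⁻¹ : ℝ) (9 / 10) := by
    have hle' : c.psiInv (c.thetaB (17 / 20) + 1) ≤ s := hsI'.1
    have := c.gUp_mem hle'
    exact ⟨by linarith [this.1], this.2.le⟩
  -- `t < s`
  have hts' : t < s := by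
    rcases lt_or_ge t s with h | h
    · exact h
    · exfalso; exact hts ⟨by linarith [hs.1], by linarith [hB.2]⟩
  -- lower bound: `psi t - 1 < psi s - 1 = thetaB (gUp s) ≤ thetaB h`
  have hlow : c.psi t - 1 < c.thetaB (x 1) := by
    have h1 : c.thetaB (c.gUp s) ≤ c.thetaB (x 1) := hanti.antitoneOn hh hgI hle
    have h2 : c.psi t < c.psi s := c.strictMono_psi hts'
    linarith
  -- upper bound: `thetaB h < thetaB (3/10) ≤ psi (tlo - ε) ≤ psi t`
  have hup : c.thetaB (x 1) < c.psi t := by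
    have h1 : c.psi (c.tlo - c.epsLo) ≤ c.psi t := c.strictMono_psi.monotone hB.1
    have h2 : c.psi (c.tlo - c.epsLo) = c.thetaB (1 / 5) - c.epsLo * c.lam := by simp only [psi]; ring
    have h3 : c.thetaB (x 1) < c.thetaB (3 / 10) := hanti (by norm_num) hh (by linarith [hx1I.1])
    have h4 : c.thetaB (3 / 10) < c.thetaB (1 / 5) := hanti (by norm_num) (by norm_num) (by norm_num)
    nlinarith
  have hn1 : (n : ℝ) < 0 := by linarith
  have hn2 : (-1 : ℝ) < n := by linarith
  have hn1' : n < 0 := by exact_mod_cast hn1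
  have hn2' : -1 < n := by exact_mod_cast hn2
  omega

/-- Disjointness (upper), lower type O parameters: heights `< 2/5` versus `> 1/2`. [folklore] -/
theorem false_of_typeO_lo_up {x : EuclideanSpace ℝ (Fin 2)} (hxsq : x ∈ squareNhd c.δ) (hx1 : 2⁻¹ < x 1) {t : ℝ}
    (hO : t ∈ Ioo (c.alo + c.epsLo) (c.tlo - c.epsLo))
    (he : ((c.band x : Metric.sphere (0 : EuclideanSpace ℝ (Fin 4)) 1) : EuclideanSpace ℝ (Fin 4)) = c.pieceFun t) : False := by
  obtain ⟨hpf, hsq, -, hlo, -, -⟩ := c.pieceFun_typeO_lo hO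
  rw [hpf] at he
  have hxe : x = c.cLo t := c.injOn hxsq hsq (Subtype.ext he)
  have : x 1 = c.cLo t 1 := by rw [hxe]
  linarith

/-- **The planar family reshaping the upper arch.** Parameters `a = alo`,
`ε_f = min (ε'/4) (alo + 1 - ahi)`, `S = [thi + ε'/4, ahi - ε'/2]`, inner `(thi + ε'/2, ahi - ε')`,
`ε' = epsHi`. [cite: HirschDT1976, Ch. 8 §1, Thm. 1.3] -/
theorem planarFamily_upperTrack (hAB : Disjoint (range ⇑A) (range ⇑B)) {X₁ H₁ : ℝ → ℝ}
    (hX₁s : ContDiff ℝ ∞ X₁) (hH₁s : ContDiff ℝ ∞ H₁)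
    (hagreeX : ∀ t, t ∉ Ioo (c.thi + c.epsHi / 2) (c.ahi - c.epsHi) → X₁ t = c.cUp t 0)
    (hagreeH : ∀ t, t ∉ Ioo (c.thi + c.epsHi / 2) (c.ahi - c.epsHi) → H₁ t = c.cUp t 1)
    (hX₁I : ∀ t, X₁ t ∈ Icc (0 : ℝ) 1) (hdX₁ : ∀ t, deriv X₁ t ≤ 0)
    (hX₁pos : ∀ t, t < c.ahi - c.epsHi → 0 < X₁ t) (hX₁lt : ∀ t, c.thi + 2 * c.epsHi < t → X₁ t < 1)
    (hH₁I : ∀ t ∈ Icc (c.thi + c.epsHi / 4) (c.ahi - c.epsHi / 2), H₁ t ∈ Ioo (2⁻¹ : ℝ) (9 / 10))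
    (hH₁le : ∀ t ∈ Icc (c.thi + c.epsHi / 4) (c.thi + 2 * c.epsHi), X₁ t = 1 → H₁ t ≤ c.gUp t)
    (hinj₁ : InjOn (fun t ↦ (pt2 (X₁ t) (H₁ t) : EuclideanSpace ℝ (Fin 2))) (Icc (c.thi + c.epsHi / 4) (c.ahi - c.epsHi / 2)))
    (hreg₁ : ∀ s ∈ Icc (c.thi + c.epsHi / 4) (c.ahi - c.epsHi / 2), deriv X₁ s = 0 → deriv H₁ s ≠ 0)
    (hco : ∀ t ∈ Icc (c.thi + c.epsHi / 4) (c.ahi - c.epsHi / 2), ∀ t' ∈ Icc (c.thi + c.epsHi / 4) (c.ahi - c.epsHi / 2),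
      t < t' → c.cUp t 0 = c.cUp t' 0 → X₁ t = X₁ t' →
      (c.cUp t 1 < c.cUp t' 1 ∧ H₁ t < H₁ t') ∨ (c.cUp t' 1 < c.cUp t 1 ∧ H₁ t' < H₁ t))
    (hcoD : ∀ s ∈ Icc (c.thi + c.epsHi / 4) (c.ahi - c.epsHi / 2),
      deriv (fun t ↦ c.cUp t 0) s = 0 → deriv X₁ s = 0 → 0 < deriv (fun t ↦ c.cUp t 1) s * deriv H₁ s) :
    (c.rebuildData hAB).PlanarFamily (c.rebuild hAB) c.alo (min (c.epsHi / 4) (c.alo + 1 - c.ahi))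
      (c.thi + c.epsHi / 4) (c.thi + c.epsHi / 2) (c.ahi - c.epsHi) (c.ahi - c.epsHi / 2)
      (fun u t ↦ pt2 ((1 - u) * c.cUp t 0 + u * X₁ t) ((1 - u) * c.cUp t 1 + u * H₁ t)) := by
  have hm := c.marks_lt
  obtain ⟨hε', hε'5, hε'lam⟩ := c.epsHi_bounds
  have hat : c.thi + 2 * c.epsHi < c.ahi - 2 * c.epsHi := c.thi_add_lt_ahi_sub
  have hahi1 : c.ahi < c.alo + 1 := by linarith [hm.2.2.2.2.2.1, hm.2.2.2.2.2.2.1, hm.2.2.2.2.2.2.2]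
  have hδ := c.δ_pos
  set ε := c.epsHi with hεdef
  have hX₀s : ContDiff ℝ ∞ (fun t ↦ c.cUp t 0) := (contDiff_euclidean.1 c.contDiff_cUp) 0
  have hH₀s : ContDiff ℝ ∞ (fun t ↦ c.cUp t 1) := (contDiff_euclidean.1 c.contDiff_cUp) 1
  have hpt : ∀ t, (pt2 (c.cUp t 0) (c.cUp t 1) : EuclideanSpace ℝ (Fin 2)) = c.cUp t := fun t ↦ by
    ext i; fin_cases i <;> rfl
  refine BandData.planarFamily_convex_antitone (c.rebuildData hAB) (lt_min (by linarith) (by linarith))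
    ⟨by linarith [min_le_left (c.epsHi / 4) (c.alo + 1 - c.ahi), hm.2.2.1, hm.2.2.2.1], by linarith, by linarith, by linarith,
      by linarith [min_le_right (c.epsHi / 4) (c.alo + 1 - c.ahi)]⟩
    hX₀s hX₁s hH₀s hH₁s hagreeX hagreeH (fun s hs ↦ ?_) (fun s hs ↦ ?_) (fun s hs ↦ ?_)
    (fun s _ ↦ c.deriv_cUp_fst_nonpos s) (fun s _ ↦ hdX₁ s) (fun t ht t' ht' he ↦ ?_) hinj₁ hco
    (fun s _ h0 ↦ ?_) hreg₁ hcoD (fun u hu s hs t ht hts ↦ ?_)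
  · rw [hpt, rebuildData_band]
    exact c.curve_rebuild_eq_band_cUp hAB ⟨by linarith [hs.1], by linarith [hs.2]⟩
  · rw [hpt, rebuildData_δ]
    exact (c.cUp_mem ⟨by linarith [hs.1], by linarith [hs.2]⟩).1
  · rw [rebuildData_δ]
    intro i; fin_cases i
    · show X₁ s ∈ Ioo (-c.δ) (1 + c.δ); exact ⟨by linarith [(hX₁I s).1], by linarith [(hX₁I s).2]⟩
    · show H₁ s ∈ Ioo (-c.δ) (1 + c.δ)
      have h := hH₁I s hs
      exact ⟨by linarith [h.1], by linarith [h.2]⟩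
  · have he' : c.cUp t = c.cUp t' := by simpa only [hpt] using he
    exact c.injective_cUp he'
  · intro h1
    apply c.deriv_cUp_ne_zero s
    have hX₀d : HasDerivAt (fun t ↦ c.cUp t 0) (deriv (fun t ↦ c.cUp t 0) s) s := ((hX₀s.differentiable (by simp)) s).hasDerivAt
    have hH₀d : HasDerivAt (fun t ↦ c.cUp t 1) (deriv (fun t ↦ c.cUp t 1) s) s := ((hH₀s.differentiable (by simp)) s).hasDerivAt
    have hc := hasDerivAt_pt2 hX₀d hH₀d
    have hfun : (fun t ↦ (pt2 (c.cUp t 0) (c.cUp t 1) : EuclideanSpace ℝ (Fin 2))) = c.cUp := funext hpt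
    rw [hfun] at hc
    rw [hc.deriv, h0, h1]
    ext i; fin_cases i <;> rfl
  · -- disjointness
    intro he
    set x : EuclideanSpace ℝ (Fin 2) := pt2 ((1 - u) * c.cUp s 0 + u * X₁ s) ((1 - u) * c.cUp s 1 + u * H₁ s) with hx
    have hsI : s ∈ Icc c.thi c.ahi := ⟨by linarith [hs.1], by linarith [hs.2]⟩
    have hx0 : x 0 = (1 - u) * c.cUp s 0 + u * X₁ s := rfl
    have hx1 : x 1 = (1 - u) * c.cUp s 1 + u * H₁ s := rfl
    have hc0 := c.cUp_zero_mem_Icc s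
    have hc1 : c.cUp s 1 ∈ Ioo (3 / 5 : ℝ) (9 / 10) := (c.cUp_mem hsI).2
    have hX := hX₁I s
    have hH := hH₁I s hs
    have hx0I : x 0 ∈ Icc (0 : ℝ) 1 := by
      rw [hx0]
      have a1 := mul_nonneg hu.1 hX.1
      have a2 := mul_nonneg (sub_nonneg.2 hu.2) hc0.1
      have a3 := mul_nonneg (sub_nonneg.2 hu.2) (sub_nonneg.2 hc0.2)
      have a4 := mul_nonneg hu.1 (sub_nonneg.2 hX.2)
      constructor <;> nlinarith
    have hx1I : x 1 ∈ Ioo (2⁻¹ : ℝ) (9 / 10) := by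
      rw [hx1]; exact convex_mem_Ioo ⟨by linarith [hc1.1], hc1.2⟩ hH hu
    have hxsq : x ∈ squareNhd c.δ := by
      intro i; fin_cases i
      · show x 0 ∈ Ioo (-c.δ) (1 + c.δ); exact ⟨by linarith [hx0I.1], by linarith [hx0I.2]⟩
      · show x 1 ∈ Ioo (-c.δ) (1 + c.δ); exact ⟨by linarith [hx1I.1], by linarith [hx1I.2]⟩
    rw [rebuildData_band] at he
    rw [c.curve_rebuild_eq_pieceFun hAB ht] at he
    rcases c.kind_cases t with hA | hB | hO | hO
    · refine c.false_of_typeA_up hxsq hs ht hts hA (fun hx00 ↦ ?_) he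
      have hsge : c.ahi - ε ≤ s := by
        by_contra hlt; push Not at hlt
        have h1 : 0 < c.cUp s 0 := by
          rw [c.cUp_apply_zero']
          rcases le_or_gt s (c.thi + ε) with h | h
          · rw [smoothStep_of_ge (by linarith) (by linarith)]; exact one_pos
          · exact (smoothStep_mem_Ioo (by linarith) ⟨by linarith, by linarith⟩).1
        have h2 : 0 < X₁ s := hX₁pos s hlt
        have : 0 < x 0 := by
          rw [hx0]
          have ha : 0 ≤ (1 - u) * c.cUp s 0 := mul_nonneg (sub_nonneg.2 hu.2) h1.le
          have hb : 0 ≤ u * X₁ s := mul_nonneg hu.1 h2.le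
          rcases hu.1.eq_or_lt with hu0 | hu0
          · rw [← hu0]; linarith
          · nlinarith
        linarith
      have hnot : s ∉ Ioo (c.thi + c.epsHi / 2) (c.ahi - c.epsHi) := fun h ↦ by linarith [h.2]
      refine ⟨hsge, ?_⟩
      rw [← hpt s]
      ext i; fin_cases i
      · show (1 - u) * c.cUp s 0 + u * X₁ s = c.cUp s 0
        rw [hagreeX s hnot]; ring
      · show (1 - u) * c.cUp s 1 + u * H₁ s = c.cUp s 1
        rw [hagreeH s hnot]; ring
    · refine c.false_of_typeB_up hxsq hx1I hs hts hB (fun hx01 ↦ ?_) he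
      have hsle : s ≤ c.thi + 2 * ε := by
        by_contra hlt; push Not at hlt
        have h1 : c.cUp s 0 < 1 := by
          rw [c.cUp_apply_zero']
          rcases lt_or_ge s (c.ahi - ε) with h | h
          · exact (smoothStep_mem_Ioo (by linarith) ⟨by linarith, by linarith⟩).2
          · rw [smoothStep_of_le (by linarith) (by linarith)]; norm_num
        have h2 : X₁ s < 1 := hX₁lt s hlt
        have : x 0 < 1 := by
          rw [hx0]
          rcases hu.1.eq_or_lt with hu0 | hu0
          · rw [← hu0]; linarith
          · have : 0 < u * (1 - X₁ s) := mul_pos hu0 (sub_pos.2 h2)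
            have h' : 0 ≤ (1 - u) * (1 - c.cUp s 0) := mul_nonneg (sub_nonneg.2 hu.2) (sub_nonneg.2 h1.le)
            nlinarith
        linarith
      refine ⟨hsle, ?_⟩
      have hv : c.cUp s 1 = c.gUp s := c.cUp_snd_eq_gUp_of_le hsle
      rcases hu.1.eq_or_lt with hu0 | hu0
      · rw [hx1, ← hu0, hv]; simp
      · have hX1 : X₁ s = 1 := by
          have h1 : c.cUp s 0 ≤ 1 := hc0.2
          have h2 : X₁ s ≤ 1 := hX.2
          rw [hx0] at hx01
          have ha : 0 ≤ (1 - u) * (1 - c.cUp s 0) := mul_nonneg (sub_nonneg.2 hu.2) (sub_nonneg.2 h1)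
          have hb : 0 ≤ u * (1 - X₁ s) := mul_nonneg hu.1 (sub_nonneg.2 h2)
          have hb0 : u * (1 - X₁ s) = 0 := by linarith
          rcases mul_eq_zero.1 hb0 with h | h
          · exact absurd h hu0.ne'
          · linarith
        have hH1 := hH₁le s ⟨hs.1, hsle⟩ hX1
        have hpos : 0 ≤ u * (c.gUp s - H₁ s) := mul_nonneg hu.1 (sub_nonneg.2 hH1)
        rw [hx1, hv]; linarith
    · exact c.false_of_typeO_lo_up hxsq hx1I.1 hO he
    · exact hts ⟨by linarith [hO.1], by linarith [hO.2]⟩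

end BandCore

end Literature.Topology.FourManifolds
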